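import Summits.FinalStateConjecture.FinalStateConjecture.Theorems.PhaseMixingCaptureCaptureSufficesTameNoC0KerrSide
import HarnessLib

/-!
# NoC0KerrChart, tube analysis I: the forward drift `∂_{t*}` and the drifted photon orbit

Line `only-the-third-law-is-generic` of crux `CaptureSufficesTame` (stmt-FinalStateConjecture-17270), stub
`stub_noC0_tubeAnalysis` (helper file, registered sub-goal `stub_noC0_tubeDrift`), lead c10. Explicit
Kerr–Schild algebra (`g = η + 2H ℓ ⊗ ℓ`, `H ≥ 0`, `ℓ(∂_{t*}) = 1`):

* (DL) `kerr_bilin_basisVector_zero_le_of_le` — wherever `H ≤ 2/5`, a future vector `v` that is nearly causal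
  (`g(v, v) ≤ (v⁰)²/20`) has `g(v, ∂_{t*}) ≤ −v⁰/20`: the static direction is a uniform "forward" direction;
* (DL2) `kerr_bilin_le_of_opNorm_le` — if `B` is `ε`-close to `g_x` in operator norm (`ε ≤ 1/4`) and
  `B(v, v) ≤ 0` then `g_x(v, v) ≤ 4ε (v⁰)²` (by (K2): `‖v‖ ≤ 2|v⁰|`);
* (DL3) `kerr_bilin_add_smul_basisVector_zero_le` — the forward DRIFT: for such `v` with `v⁰ = 1` and
  `κ ≥ 0`, `g_x(v + κ ∂_{t*}, v + κ ∂_{t*}) ≤ 4ε − κ/10`;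
* (INC) `kerr_drifted_orbitCurve` — the retrograde photon orbit reparametrised by `t*` and drifted forward,
  `w ↦ orbitCurve a r₀ q (w/e) + κ w ∂_{t*}` (`e = 1 − aq ∈ (0, 1]`), has velocity
  `V = e⁻¹ orbitVel + κ ∂_{t*}` with `g(V, V) ≤ −κ/10`, `V⁰ = 1 + κ`, `‖V‖ ≤ 3 + κ`.

References: M. Visser, arXiv:0706.0622, (32)–(35) (key `arXiv07060622`); J. Sbierski, Anal. PDE 8 (2015), §7A
(key `Sbierski2015`).
-/

set_option linter.dupNamespace false
set_option maxSynthPendingDepth 3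

noncomputable section

open Set Filter Function Bundle Metric
open scoped Manifold ContDiff Topology

namespace Summit.FinalStateConjecture.FinalStateConjecture.Theorems.PhaseMixingCaptureCaptureSufficesTame

open Literature.Geometry.Lorentzian

namespace NoC0

/-! ## (DL) The static direction is uniformly forward for nearly-causal future vectors -/

/-- **(DL)** For `0 ≤ M`, at a point with `H ≤ 2/5`, a vector `v` with `v⁰ > 0` and `g(v, v) ≤ (v⁰)²/20` has
`g(v, ∂_{t*}) = −v⁰ + 2H ℓ(v) ≤ −v⁰/20` (`g = η + 2H ℓ ⊗ ℓ`, `ℓ₀ = 1`, `η(v, ∂_{t*}) = −v⁰`; if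
`2H ℓ(v) > (19/20) v⁰` then `(2Hℓ(v))² = 2H · 2Hℓ(v)² ≤ (4/5)(21/20)(v⁰)² < (19/20)²(v⁰)²`). Visser
arXiv:0706.0622, (32)–(35). [cite: arXiv07060622, (32)–(35)] -/
theorem kerr_bilin_basisVector_zero_le_of_le (M a : ℝ) (x v : E4) (hM : 0 ≤ M)
    (hH : Kerr.scalarH M a x ≤ 2 / 5) (hv0 : 0 < v 0) (hv : Kerr.bilin M a x v v ≤ (1 / 20) * (v 0) ^ 2) :
    Kerr.bilin M a x v (E4.basisVector 0) ≤ -(1 / 20) * v 0 := by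
  have hH0 := Kerr.scalarH_nonneg hM a x
  rw [Kerr.bilin_apply, Minkowski.bilin_symm v (E4.basisVector 0), Minkowski.bilin_basisVector_zero_left,
    Kerr.nullCovector_basisVector_zero, mul_one]
  rw [Kerr.bilin_apply, minkowski_bilin_self_eq_spatial_sub_time] at hv
  set H := Kerr.scalarH M a x with hH_def
  set u := Kerr.nullCovector a x v with hu_def
  have hS := sq_nonneg (E4.spatialNorm v)
  have h2 : 2 * H * u ^ 2 ≤ (21 / 20) * (v 0) ^ 2 := by nlinarith
  by_contra h1
  push Not at h1
  have h1' : 19 / 20 * v 0 < 2 * H * u := by linarith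
  have hA : (19 / 20 * v 0) * (19 / 20 * v 0) < (2 * H * u) * (2 * H * u) :=
    mul_lt_mul'' h1' h1' (by positivity) (by positivity)
  have hB : (2 * H * u) * (2 * H * u) = 2 * H * (2 * H * u ^ 2) := by ring
  have hC : 2 * H * (2 * H * u ^ 2) ≤ 2 * H * ((21 / 20) * (v 0) ^ 2) :=
    mul_le_mul_of_nonneg_left h2 (by positivity)
  have hD : 2 * H * ((21 / 20) * (v 0) ^ 2) ≤ 2 * (2 / 5) * ((21 / 20) * (v 0) ^ 2) := by gcongr
  nlinarith [sq_nonneg (v 0)]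

/-! ## (DL2) Nearly causal for a perturbed cone is nearly causal for `g` -/

/-- **(DL2)** If `‖B − g_{M,a}(x)‖ ≤ ε ≤ 1/4` and `B(v, v) ≤ 0` then `g_{M,a}(x)(v, v) ≤ 4ε (v⁰)²`
(`|B(v,v) − g(v,v)| ≤ ε‖v‖²` and `‖v‖ ≤ 2|v⁰|` by (K2)). Visser arXiv:0706.0622, (32)–(35).
[cite: arXiv07060622, (32)–(35)] -/
theorem kerr_bilin_le_of_opNorm_le (M a : ℝ) (x v : E4) (B : E4 →L[ℝ] E4 →L[ℝ] ℝ) (ε : ℝ) (hM : 0 ≤ M)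
    (hB : ‖B - Kerr.bilin M a x‖ ≤ ε) (hε : ε ≤ 1 / 4) (hv : B v v ≤ 0) :
    Kerr.bilin M a x v v ≤ 4 * ε * (v 0) ^ 2 := by
  have h1 : ‖(B - Kerr.bilin M a x) v v‖ ≤ ‖B - Kerr.bilin M a x‖ * ‖v‖ * ‖v‖ :=
    (B - Kerr.bilin M a x).le_opNorm₂ v v
  rw [Real.norm_eq_abs, sub_apply, sub_apply] at h1
  have hn : ‖v‖ ≤ 2 * |v 0| := kerr_norm_le_two_mul_abs_time M a x v B hM (hB.trans hε) hv
  have hε0 : 0 ≤ ε := (norm_nonneg _).trans hB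
  have h2 : |B v v - Kerr.bilin M a x v v| ≤ ε * ((2 * |v 0|) * (2 * |v 0|)) := by
    refine h1.trans ?_
    rw [mul_assoc]
    exact mul_le_mul hB (mul_le_mul hn hn (norm_nonneg _) (by positivity)) (by positivity) hε0
  have h3 := (abs_le.1 h2).1
  have h4 : (2 * |v 0|) * (2 * |v 0|) = 4 * (v 0) ^ 2 := by
    rw [pow_two, ← abs_mul_abs_self (v 0)]
    ring
  rw [h4] at h3
  linarith

/-! ## (DL3) The forward drift makes perturbed-causal vectors `g`-timelike with margin -/

/-- **(DL3) The forward drift.** If `H(x) ≤ 2/5`, `‖B − g_{M,a}(x)‖ ≤ ε ≤ 1/80`, `B(v, v) ≤ 0`, `v⁰ = 1` and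
`κ ≥ 0`, then `g_{M,a}(x)(v + κ∂_{t*}, v + κ∂_{t*}) ≤ 4ε − κ/10`: expand bilinearly and use (DL2)
(`g(v,v) ≤ 4ε ≤ 1/20`), (DL) (`g(v, ∂_{t*}) ≤ −1/20`) and `g(∂_{t*}, ∂_{t*}) = −1 + 2H ≤ 0`. Visser
arXiv:0706.0622, (32)–(35). [cite: arXiv07060622, (32)–(35)] -/
theorem kerr_bilin_add_smul_basisVector_zero_le (M a : ℝ) (x v : E4) (B : E4 →L[ℝ] E4 →L[ℝ] ℝ) (ε κ : ℝ)
    (hM : 0 ≤ M) (hH : Kerr.scalarH M a x ≤ 2 / 5) (hB : ‖B - Kerr.bilin M a x‖ ≤ ε) (hε : ε ≤ 1 / 80)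
    (hv : B v v ≤ 0) (hv0 : v 0 = 1) (hκ : 0 ≤ κ) :
    Kerr.bilin M a x (v + κ • E4.basisVector 0) (v + κ • E4.basisVector 0) ≤ 4 * ε - κ / 10 := by
  have h1 : Kerr.bilin M a x v v ≤ 4 * ε := by
    have := kerr_bilin_le_of_opNorm_le M a x v B ε hM hB (by linarith) hv
    rwa [hv0, one_pow, mul_one] at this
  have h2 : Kerr.bilin M a x v (E4.basisVector 0) ≤ -(1 / 20) := by
    have := kerr_bilin_basisVector_zero_le_of_le M a x v hM hH (by rw [hv0]; exact one_pos)
      (by rw [hv0]; linarith)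
    rwa [hv0, mul_one] at this
  -- `g(∂_{t*}, ∂_{t*}) = −1 + 2H ≤ 0` (the tree's `kerrBilin_e0_e0` identity, inlined)
  have h3 : Kerr.bilin M a x (E4.basisVector 0) (E4.basisVector 0) ≤ 0 := by
    rw [Kerr.bilin_apply, Minkowski.bilin_basisVector_zero, Kerr.nullCovector_basisVector_zero, mul_one, mul_one]
    linarith
  have hexp : Kerr.bilin M a x (v + κ • E4.basisVector 0) (v + κ • E4.basisVector 0) =
      Kerr.bilin M a x v v + 2 * κ * Kerr.bilin M a x v (E4.basisVector 0) +
        κ ^ 2 * Kerr.bilin M a x (E4.basisVector 0) (E4.basisVector 0) := by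
    simp only [map_add, map_smul, add_apply, smul_apply, smul_eq_mul]
    rw [Kerr.bilin_symm M a x (E4.basisVector 0) v]
    ring
  rw [hexp]
  have h4 : κ * Kerr.bilin M a x v (E4.basisVector 0) ≤ κ * (-(1 / 20)) := mul_le_mul_of_nonneg_left h2 hκ
  have h5 : κ ^ 2 * Kerr.bilin M a x (E4.basisVector 0) (E4.basisVector 0) ≤ 0 :=
    mul_nonpos_of_nonneg_of_nonpos (sq_nonneg κ) h3
  linarith

/-! ## (INC) The drifted, `t*`-parametrised photon orbit -/

/-- **(INC) The incidence curve.** For the retrograde photon radius `r₀` (`0 < M`, `0 ≤ a ≤ M`, `3M ≤ r₀`,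
`r₀(r₀ − 3M)² = 4a²M`), `q = √(M/r₀³)`, `e = 1 − aq` and `κ > 0`: `0 < e ≤ 1` (`(aq)² = a²M/r₀³ ≤ 1/27`),
`0 < q`, the curve `w ↦ orbitCurve a r₀ q (w/e) + κ w ∂_{t*}` has velocity `V = e⁻¹ orbitVel + κ ∂_{t*}` with
`g(V, V) = 2(κ/e) g(orbitVel, ∂_{t*}) + κ² g(∂_{t*}, ∂_{t*}) ≤ −κ/10` (nullity `Kerr.bilin_orbitVel_self`,
stationarity `Kerr.bilin_add_smul_basisVector_zero`, (DL) at the orbit where `H = M/r₀ ≤ 1/3`, (W1)),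
`V⁰ = 1 + κ` and `‖V‖ ≤ 3 + κ` (`‖orbitVel‖² = e² + q²(r₀² + a²) ≤ e² + 10/27`, `e > 4/5`). Sbierski 2015,
§7A; Visser arXiv:0706.0622, (32)–(35). [cite: Sbierski2015, §7A] -/
theorem kerr_drifted_orbitCurve (M a r₀ q e κ w : ℝ) (hM : 0 < M) (ha0 : 0 ≤ a) (haM : a ≤ M)
    (h3M : 3 * M ≤ r₀) (hcubic : r₀ * (r₀ - 3 * M) ^ 2 = 4 * a ^ 2 * M) (hq : q = √(M / r₀ ^ 3))
    (he : e = 1 - a * q) (hκ : 0 < κ) :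
    0 < e ∧ e ≤ 1 ∧ 0 < q ∧
      HasDerivAt (fun w ↦ Kerr.orbitCurve a r₀ q (w / e) + (κ * w) • E4.basisVector 0)
        ((1 / e) • Kerr.orbitVel a q (Kerr.orbitCurve a r₀ q (w / e)) + κ • E4.basisVector 0) w ∧
      Kerr.bilin M a (Kerr.orbitCurve a r₀ q (w / e) + (κ * w) • E4.basisVector 0)
        ((1 / e) • Kerr.orbitVel a q (Kerr.orbitCurve a r₀ q (w / e)) + κ • E4.basisVector 0)
        ((1 / e) • Kerr.orbitVel a q (Kerr.orbitCurve a r₀ q (w / e)) + κ • E4.basisVector 0) ≤ -(κ / 10) ∧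
      ((1 / e) • Kerr.orbitVel a q (Kerr.orbitCurve a r₀ q (w / e)) + κ • E4.basisVector 0) 0 = 1 + κ ∧
      ‖(1 / e) • Kerr.orbitVel a q (Kerr.orbitCurve a r₀ q (w / e)) + κ • E4.basisVector 0‖ ≤ 3 + κ := by
  have hr₀ : 0 < r₀ := by linarith
  have hq0 : 0 < q := by rw [hq]; exact Real.sqrt_pos.2 (by positivity)
  have hq2 : q ^ 2 = M / r₀ ^ 3 := by rw [hq]; exact Real.sq_sqrt (by positivity)
  have hqr : q ^ 2 * r₀ ^ 3 = M := by rw [hq2]; field_simp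
  -- `(aq)² ≤ 1/27`, so `aq < 1/5` and `4/5 < e ≤ 1`
  have haq2 : (a * q) ^ 2 * r₀ ^ 3 = a ^ 2 * M := by rw [mul_pow, mul_assoc, hqr]
  have h27 : (3 * M) ^ 3 ≤ r₀ ^ 3 := pow_le_pow_left₀ (by linarith) h3M 3
  have haM2 : a ^ 2 * M ≤ M ^ 2 * M := mul_le_mul_of_nonneg_right (pow_le_pow_left₀ ha0 haM 2) hM.le
  have haq_sq : (a * q) ^ 2 ≤ 1 / 27 := by
    have h : (a * q) ^ 2 * r₀ ^ 3 ≤ 1 / 27 * r₀ ^ 3 :=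
      calc (a * q) ^ 2 * r₀ ^ 3 = a ^ 2 * M := haq2
        _ ≤ M ^ 2 * M := haM2
        _ = M ^ 3 := by ring
        _ ≤ (r₀ / 3) ^ 3 := pow_le_pow_left₀ hM.le (by linarith) 3
        _ = 1 / 27 * r₀ ^ 3 := by ring
    exact le_of_mul_le_mul_right h (pow_pos hr₀ 3)
  have haq0 : 0 ≤ a * q := mul_nonneg ha0 hq0.le
  have haq : a * q < 1 / 5 := lt_of_pow_lt_pow_left₀ 2 (by norm_num) (by linarith)
  have he0 : 0 < e := by rw [he]; linarith
  have he1 : e ≤ 1 := by rw [he]; linarith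
  have he45 : 4 / 5 < e := by rw [he]; linarith
  set p := Kerr.orbitCurve a r₀ q (w / e) with hp
  set ov := Kerr.orbitVel a q p with hov
  set V := (1 / e) • ov + κ • E4.basisVector 0 with hV
  -- the velocity
  have hD : HasDerivAt (fun w ↦ Kerr.orbitCurve a r₀ q (w / e) + (κ * w) • E4.basisVector 0) V w := by
    have h1 : HasDerivAt (fun w : ℝ ↦ w / e) (1 / e) w := (hasDerivAt_id w).div_const e
    have h2 : HasDerivAt (fun w : ℝ ↦ Kerr.orbitCurve a r₀ q (w / e)) ((1 / e) • ov) w := by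
      have := HasDerivAt.scomp w (Kerr.hasDerivAt_orbitCurve (a := a) (r₀ := r₀) (q := q) (w / e)) h1
      exact this
    have h3 : HasDerivAt (fun w : ℝ ↦ (κ * w) • E4.basisVector 0) (κ • E4.basisVector 0) w := by
      simpa using ((hasDerivAt_id w).const_mul κ).smul_const (E4.basisVector 0)
    exact h2.add h3
  -- the orbit point: `z = 0`, `r = r₀`, `H = M/r₀ ≤ 1/3`
  have hp3 : p 3 = 0 := Kerr.orbitCurve_apply_three _
  have hrad : Kerr.radius a p = r₀ := Kerr.radius_orbitCurve hr₀ _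
  have hHp : Kerr.scalarH M a p = M / r₀ := by
    rw [Kerr.scalarH_of_apply_three_eq_zero M hp3 (by rw [hrad]; exact hr₀), hrad]
  have hH25 : Kerr.scalarH M a p ≤ 2 / 5 := by
    rw [hHp, div_le_iff₀ hr₀]
    linarith
  have hnull : Kerr.bilin M a p ov ov = 0 := Kerr.bilin_orbitVel_self hM ha0 h3M hq0.le hqr hcubic _
  have hov0 : ov 0 = e := by rw [hov, Kerr.orbitVel_apply_zero, he]
  have hcross : Kerr.bilin M a p ov (E4.basisVector 0) ≤ -(1 / 20) * e := by
    have := kerr_bilin_basisVector_zero_le_of_le M a p ov hM.le hH25 (by rw [hov0]; exact he0)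
      (by rw [hnull]; positivity)
    rwa [hov0] at this
  have he0e0 : Kerr.bilin M a p (E4.basisVector 0) (E4.basisVector 0) ≤ -(1 / 3) :=
    kerr_bilin_basisVector_zero_le M a p hM.le (by rw [hrad]; exact h3M)
  have hexp : Kerr.bilin M a p V V = (1 / e) ^ 2 * Kerr.bilin M a p ov ov +
      2 * (κ / e) * Kerr.bilin M a p ov (E4.basisVector 0) +
        κ ^ 2 * Kerr.bilin M a p (E4.basisVector 0) (E4.basisVector 0) := by
    simp only [hV, map_add, map_smul, add_apply, smul_apply, smul_eq_mul]
    rw [Kerr.bilin_symm M a p (E4.basisVector 0) ov]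
    ring
  have hmetric : Kerr.bilin M a (p + (κ * w) • E4.basisVector 0) V V ≤ -(κ / 10) := by
    rw [Kerr.bilin_add_smul_basisVector_zero M a p (κ * w), hexp, hnull, mul_zero, zero_add]
    have h4 : 2 * (κ / e) * Kerr.bilin M a p ov (E4.basisVector 0) ≤ 2 * (κ / e) * (-(1 / 20) * e) :=
      mul_le_mul_of_nonneg_left hcross (by positivity)
    have h5 : 2 * (κ / e) * (-(1 / 20) * e) = -(κ / 10) := by
      field_simp
      ring
    have h6 : κ ^ 2 * Kerr.bilin M a p (E4.basisVector 0) (E4.basisVector 0) ≤ 0 :=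
      mul_nonpos_of_nonneg_of_nonpos (sq_nonneg κ) (by linarith)
    linarith
  -- the time component
  have hV0 : V 0 = 1 + κ := by
    have hb0 : (E4.basisVector 0 : E4) 0 = 1 := by simp
    rw [hV, PiLp.add_apply, PiLp.smul_apply, PiLp.smul_apply, smul_eq_mul, smul_eq_mul, hov0, hb0, mul_one,
      one_div, inv_mul_cancel₀ he0.ne']
  -- the Euclidean norm
  have hnorm : ‖V‖ ≤ 3 + κ := by
    have h1 : ‖V‖ ≤ ‖(1 / e) • ov‖ + ‖κ • E4.basisVector 0‖ := norm_add_le _ _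
    have h2 : ‖(1 / e) • ov‖ = (1 / e) * ‖ov‖ := by
      rw [norm_smul, Real.norm_eq_abs, abs_of_pos (by positivity)]
    have h3 : ‖κ • E4.basisVector 0‖ = κ := by
      have hn1 : ‖(E4.basisVector 0 : E4)‖ = 1 := by simp
      rw [norm_smul, hn1, mul_one, Real.norm_eq_abs, abs_of_pos hκ]
    have hc : p 1 ^ 2 + p 2 ^ 2 = r₀ ^ 2 + a ^ 2 := Kerr.orbitCurve_circle _
    have hov_sq : ‖ov‖ ^ 2 = e ^ 2 + q ^ 2 * (r₀ ^ 2 + a ^ 2) := by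
      rw [EuclideanSpace.real_norm_sq_eq, Fin.sum_univ_four, hov, Kerr.orbitVel_apply_zero,
        Kerr.orbitVel_apply_one, Kerr.orbitVel_apply_two, Kerr.orbitVel_apply_three, ← he, ← hc]
      ring
    have hb1 : q ^ 2 * r₀ ^ 2 ≤ 1 / 3 := by
      have h : q ^ 2 * r₀ ^ 2 * r₀ ≤ 1 / 3 * r₀ :=
        calc q ^ 2 * r₀ ^ 2 * r₀ = q ^ 2 * r₀ ^ 3 := by ring
          _ = M := hqr
          _ ≤ 1 / 3 * r₀ := by linarith
      exact le_of_mul_le_mul_right h hr₀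
    have hb2 : q ^ 2 * a ^ 2 ≤ 1 / 27 := by rw [mul_comm, ← mul_pow]; exact haq_sq
    have he2 : 16 / 25 < e ^ 2 := by nlinarith [he45]
    have hov3 : ‖ov‖ ≤ 3 * e := by
      refine (sq_le_sq₀ (norm_nonneg _) (by positivity)).1 ?_
      rw [hov_sq, mul_pow, mul_add]
      linarith
    have h4 : (1 / e) * ‖ov‖ ≤ 3 := by
      rw [one_div, inv_mul_le_iff₀ he0]
      linarith
    calc ‖V‖ ≤ (1 / e) * ‖ov‖ + κ := by rw [← h2, ← h3]; exact h1
      _ ≤ 3 + κ := by linarith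
  exact ⟨he0, he1, hq0, hD, hmetric, hV0, hnorm⟩

end NoC0

/-- **Registered sub-goal `stub_noC0_tubeDrift`** (helper of `stub_noC0_tubeAnalysis`, NoC0KerrChart programme): the conjunction
(DL) ∧ (DL2) ∧ (DL3) ∧ (INC) of the forward-drift estimates and the drifted photon orbit, verbatim.
[cite: arXiv07060622, (32)–(35)] [cite: Sbierski2015, §7A] -/
theorem stub_noC0_tubeDrift :
    (∀ (M a : ℝ) (x v : E4), 0 ≤ M → Kerr.scalarH M a x ≤ 2 / 5 → 0 < v 0 →
      Kerr.bilin M a x v v ≤ (1 / 20) * (v 0) ^ 2 →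
      Kerr.bilin M a x v (E4.basisVector 0) ≤ -(1 / 20) * v 0) ∧
    (∀ (M a : ℝ) (x v : E4) (B : E4 →L[ℝ] E4 →L[ℝ] ℝ) (ε : ℝ), 0 ≤ M → ‖B - Kerr.bilin M a x‖ ≤ ε →
      ε ≤ 1 / 4 → B v v ≤ 0 → Kerr.bilin M a x v v ≤ 4 * ε * (v 0) ^ 2) ∧
    (∀ (M a : ℝ) (x v : E4) (B : E4 →L[ℝ] E4 →L[ℝ] ℝ) (ε κ : ℝ), 0 ≤ M → Kerr.scalarH M a x ≤ 2 / 5 →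
      ‖B - Kerr.bilin M a x‖ ≤ ε → ε ≤ 1 / 80 → B v v ≤ 0 → v 0 = 1 → 0 ≤ κ →
      Kerr.bilin M a x (v + κ • E4.basisVector 0) (v + κ • E4.basisVector 0) ≤ 4 * ε - κ / 10) ∧
    (∀ (M a r₀ q e κ w : ℝ), 0 < M → 0 ≤ a → a ≤ M → 3 * M ≤ r₀ → r₀ * (r₀ - 3 * M) ^ 2 = 4 * a ^ 2 * M →
      q = √(M / r₀ ^ 3) → e = 1 - a * q → 0 < κ →
      0 < e ∧ e ≤ 1 ∧ 0 < q ∧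
      HasDerivAt (fun w ↦ Kerr.orbitCurve a r₀ q (w / e) + (κ * w) • E4.basisVector 0)
        ((1 / e) • Kerr.orbitVel a q (Kerr.orbitCurve a r₀ q (w / e)) + κ • E4.basisVector 0) w ∧
      Kerr.bilin M a (Kerr.orbitCurve a r₀ q (w / e) + (κ * w) • E4.basisVector 0)
        ((1 / e) • Kerr.orbitVel a q (Kerr.orbitCurve a r₀ q (w / e)) + κ • E4.basisVector 0)
        ((1 / e) • Kerr.orbitVel a q (Kerr.orbitCurve a r₀ q (w / e)) + κ • E4.basisVector 0) ≤ -(κ / 10) ∧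
      ((1 / e) • Kerr.orbitVel a q (Kerr.orbitCurve a r₀ q (w / e)) + κ • E4.basisVector 0) 0 = 1 + κ ∧
      ‖(1 / e) • Kerr.orbitVel a q (Kerr.orbitCurve a r₀ q (w / e)) + κ • E4.basisVector 0‖ ≤ 3 + κ) :=
  ⟨NoC0.kerr_bilin_basisVector_zero_le_of_le, NoC0.kerr_bilin_le_of_opNorm_le,
    NoC0.kerr_bilin_add_smul_basisVector_zero_le, NoC0.kerr_drifted_orbitCurve⟩

end Summit.FinalStateConjecture.FinalStateConjecture.Theorems.PhaseMixingCaptureCaptureSufficesTame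

end
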